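import Summits.Schanuel.Schanuel.Theorems.RootDecomp1KDigitPincer01

/-!
# RootDecomp1KDigitPincer — lens 1, generation 66, NODE 26 «THE SECOND-ORDER 2-ADIC DIGIT PINCER ON THE K-LINE — the standing witness X6 = x³ + Y·x + Y⁷ + 3 decided: EMPTY AT EVERY LEVEL» (×0-as-record: node 9's toolkit programme §8 (a); the odd-middle pencil XP b c = x³ + b·x·Y + Y⁷ + c, b odd, EMPTY at every level N ≠ 1 with 2^N ≥ 2|b| + 9 + |c| and at N = 0, 2 ≤ N ≤ 6; X6P / X5P / X3P at every level; elementary: p_N ≡ 1 mod 2^(N!−(N−1)!) against the far-edge congruence and the real window; CLAIM L3006, PRICE L3009, ERRATUM E4, RULE K-R57, VERDICT L3015) — continuation (RootDecomp1KDigitPincer02): §6 the chain at a level N, named step by step; the pencil engine no_level_XP_of_pow_le / no_level_XP_lt_seven / levelFinite_XP / bddLevelEmpty_XP / thinFibreAt_XP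

(lens-1 g66 NODE 26 «THE SECOND-ORDER 2-ADIC DIGIT PINCER ON THE K-LINE — the standing witness X6 = x³ + Y·x + Y⁷ + 3 decided: EMPTY AT EVERY LEVEL» L3013: HOME kernel K = HOME/decomp-schanuel-lens-1/g66/lean/DigitPincer.lean sha256 70263161…, 778 l, 67 decls, ONE namespace `Summit.Schanuel.Schanuel.Theorems.RootDecomp1KDigitPincer`, imports the tree port …RootDecomp1KW4Dossier01 ONLY; no private / instance / set_option / notation / sorry / decide; lens farm rc 0 · 0 errors · 0 sorries · 67 dupNamespace, axioms standard, Probe rc 0; CLAIM L3006 (ASK-FIRST under K-R56 (iii)(d)); crit g12 PRICE L3009: ×0-AS-RECORD (the pincer = node 9's TOOLKIT programme §8 (a) of RootDecomp1KDegreeLadder08 l.34–55), ERRATUM E4 («the dominant-far standing witnesses were reachable by the toolkit all along»: X6's certificate L3000 REVOKED, X5 MOOT, X3 struck (E3) ∧ decided), RULE K-R57 PRE-ANNOUNCED, CHECKLIST K-g66; writer g34 NOTE 13 L3008 (pre-check: precision (α) level N = 1, exact enumeration at levels 0–6); crit VERDICT L3015 (2026-09-02T01:34Z): CLEARED FOR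 THE RECORD ×0-AS-RECORD, CHECKLIST K-g66 (1)–(8) MET, RULE K-R57 FIXED (clauses (i)–(iv) of PRICE L3009 (4) verbatim + GLOSS K-R57), tally UNCHANGED lens-1 ×21 + THEOREM ×23, PORT GO → census-1 (source = K verbatim + provenance block; `--supports stmt-Schanuel-33364`, the item stays OPEN; RULE K-R57 (iv): UNCONDITIONAL PART ∪= these names). Port by census-1 gen 24 as `RootDecomp1KDigitPincer01–03` (×0 record port, no credit anywhere; files ≤ 400 lines): 01 = header + §0 the pencil `xc` / `XP b c` / `X6P` with `XP_one_two_eq_X5P` / `XP_one_zero_eq_X3P` (node 25's terms NOT re-declared) + §1 parity bookkeeping + §2 (P1) clearing denominators + §3 (P2)–(P3) den = 2^e and the tie 7e = 3M + §4 (P4)–(P5) the digit congruence 2^K ∣ a + 1 and a ≠ −1 + §5 (P6) the archimedean window; 02 = §6 the chain at a level N named step by step (`den_eq_two_pow_of_level`, `seven_e_eq_three_M`, `two_pow_dvd_num_add_one`, `num_ne_neg_one`, `abs_num_window`, …, `no_level_XP_of_pow_le`, `no_level_XP_lt_seven`, `levelFinite_XP`, `bddLevelEmpty_XP`, `thinFibreAt_XP`);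 03 = §7 BY NAME `no_level_one`, `no_level_X6P`, `levelSet_X6P_eq_empty`, `levelFinite_X6P`, `bddLevelEmpty_X6P`, `thinFibreAt_X6P`, `thinFibreAt_two_X6P`, the same five for the tree's `X5P` + §T territory `not_decidedAt_two_X6P`, `not_localAt_X6P`, `not_fermatTri_X6P`, `not_domSuper_X6P`, `not_domHyper_X6P`, `X6P_territory`. DROPPED AS A BLOCK (VERDICT L3015 option «the X3P twins may be kept or dropped as a block; say which»): the three twins `no_level_X3P_pincer` / `levelFinite_X3P_pincer` / `thinFibreAt_X3P_pincer` (K l.650–668) — their STATEMENTS coincide with node 25's landed `RootDecomp1KTrinomialDescent.no_level_X3P` / `levelFinite_X3P` / `thinFibreAt_X3P` and the gate's dedup.landed lint bounces such restatements; node 25's names stay the record for X3. Everything else = K VERBATIM (every declaration documented by the lens; statements, names and proofs unchanged; K's module docstring kept in part 01 below this provenance block).)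
-/

noncomputable section

namespace Summit.Schanuel.Schanuel.Theorems.RootDecomp1KDigitPincer

open Polynomial Finset
open LiouvilleNumber
open scoped Nat
open Summit.Schanuel.Schanuel.Theorems.RootDecomp1KDegreeLadder
open Summit.Schanuel.Schanuel.Theorems.RootDecomp1KXTop
open Summit.Schanuel.Schanuel.Theorems.RootDecomp1KXAll
open Summit.Schanuel.Schanuel.Theorems.RootDecomp1KLevelFinite
open Summit.Schanuel.Schanuel.Theorems.RootDecomp1KHeightGrading (BddLevelEmpty bddLevelEmpty_iff_levelFinite)
open Summit.Schanuel.Schanuel.Theorems.RootDecomp1KOddEmpty (levelFinite_of_no_level)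
open Summit.Schanuel.Schanuel.Theorems.RootDecomp1KTwoBaseCell (psNumer partialSum_eq_psNumer_div coprime_psNumer
  partialSum_lt_two partialSum_pos')
open Summit.Schanuel.Schanuel.Theorems.RootDecomp1KTrinomialDescent (two_adic_tie two_adic_strict X5P x5C X3P x3C
  FermatTri not_fermatTri_of_two_coeffs)
open Summit.Schanuel.Schanuel.Theorems.RootDecomp1KSuperellipticSiegel (DomSuper partialSum_two_one)
open Summit.Schanuel.Schanuel.Theorems.RootDecomp1KHyperellipticSiegel (DomHyper)
open Summit.Schanuel.Schanuel.Theorems.RootDecomp1KXLinear (xLinP bev_xLinP XLinearLt)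
open Summit.Schanuel.Schanuel.Theorems.RootDecomp1KLocalExponent (LocalAt SlopeCond RootCond)

/-! ## §6  THE ABSCISSA TWO LEVELS DEEP — the chain at a LEVEL `N` (named step by step) -/

/-- the level abscissa as a dyadic fraction: `s_N = p_N / 2^{N!}` (tree `partialSum_eq_psNumer_div`). (`private`: the same statement is landed as `RootDecomp1KTrinomialDescent.partialSum_two_eq_int_div` — the gate's dedup.landed lint bounced the verbatim file; port-side modifier, census-1 g24, precedent PORT IDENTITY L2917 / PORT GO L2990.) -/
private theorem partialSum_two_eq_div (N : ℕ) : partialSum 2 N = ((psNumer 2 N : ℤ) : ℝ) / 2 ^ N ! := by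
  have e := partialSum_eq_psNumer_div (b := 2) (by norm_num) N
  push_cast at e ⊢
  exact e

/-- the abscissa numerator `p_N` is ODD at every level `N ≠ 1` (`p_0 = 1`; tree `coprime_psNumer` for `N ≥ 2`; `p_1 = 2`). -/
theorem odd_psNumer_two {N : ℕ} (hN : N ≠ 1) : Odd (psNumer 2 N : ℤ) := by
  rcases Nat.lt_or_ge N 2 with hlt | hge
  · have hN0 : N = 0 := by omega
    subst hN0
    exact ⟨0, by simp [psNumer]⟩
  · exact (Int.odd_coe_nat _).mpr (Nat.coprime_two_right.mp (coprime_psNumer 2 hge))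

/-- **(P2)+(P3) at a level** `N ≠ 1`: a level point `(s_N, r)` of `XP b c` (`b` odd) has `den r = 2^e`, `num r` odd,
and the far edge TIES: `7e = 3·N!`; hence `7 ∣ N!`, i.e. `N ≥ 7`. -/
theorem level_shape {b : ℤ} (hb : Odd b) (c : ℤ) {N : ℕ} (hN : N ≠ 1) {r : ℚ}
    (h : bev (XP b c) (partialSum 2 N) r = 0) :
    ∃ e : ℕ, (r.den : ℤ) = 2 ^ e ∧ Odd r.num ∧ 7 * e = 3 * N ! ∧ 7 ≤ N := by
  rw [partialSum_two_eq_div] at h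
  have hM : 1 ≤ N ! := Nat.one_le_iff_ne_zero.mpr (Nat.factorial_ne_zero _)
  obtain ⟨e, hde, ha, h73, -⟩ := root_shape hb (odd_psNumer_two hN) hM h
  obtain ⟨f, hf⟩ : ∃ f, e = 3 * f := ⟨e / 3, by omega⟩
  have h7 : 7 ∣ N ! := ⟨f, by omega⟩
  have h7N := (Nat.Prime.dvd_factorial (by norm_num : Nat.Prime 7)).mp h7
  exact ⟨e, hde, ha, h73, h7N⟩

/-- (P2) named: **the denominator of a level ordinate is a power of two** (`N ≠ 1`). -/
theorem den_eq_two_pow_of_level {b : ℤ} (hb : Odd b) (c : ℤ) {N : ℕ} (hN : N ≠ 1) {r : ℚ}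
    (h : bev (XP b c) (partialSum 2 N) r = 0) : ∃ e : ℕ, r.den = 2 ^ e := by
  obtain ⟨e, hde, -, -, -⟩ := level_shape hb c hN h
  exact ⟨e, by exact_mod_cast hde⟩

/-- (P3) named: **the far-edge tie `7e = 3·N!`** for the exponent `e` of the denominator (`N ≠ 1`). -/
theorem seven_e_eq_three_M {b : ℤ} (hb : Odd b) (c : ℤ) {N : ℕ} (hN : N ≠ 1) {r : ℚ}
    (h : bev (XP b c) (partialSum 2 N) r = 0) {e : ℕ} (he : r.den = 2 ^ e) : 7 * e = 3 * N ! := by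
  obtain ⟨e', hde, -, h73, -⟩ := level_shape hb c hN h
  have h1 : (2 : ℕ) ^ e = 2 ^ e' := by
    have : ((r.den : ℕ) : ℤ) = ((2 ^ e' : ℕ) : ℤ) := by rw [hde]; push_cast; rfl
    rw [← he]; exact_mod_cast this
  have := Nat.pow_right_injective le_rfl h1
  subst this
  exact h73

/-- (P3) corollary named: **a level carrying a point has `N ≥ 7`** (`N ≠ 1`). -/
theorem seven_le_of_level {b : ℤ} (hb : Odd b) (c : ℤ) {N : ℕ} (hN : N ≠ 1) {r : ℚ}
    (h : bev (XP b c) (partialSum 2 N) r = 0) : 7 ≤ N :=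
  (level_shape hb c hN h).elim fun _ he => he.2.2.2

/-- **(P4)+(P5) at a level** (`N ≠ 1`; the abscissa read TWO LEVELS DEEP: `p_N = 2^{N!−(N−1)!}·p_{N−1} + 1`, `p_{N−1}` odd —
tree `psNumer_succ`, `coprime_psNumer`): `2^{N!−(N−1)!} ∣ num r + 1` and `num r ≠ −1`. -/
theorem level_digits {b : ℤ} (hb : Odd b) (c : ℤ) {N : ℕ} (hN : N ≠ 1) {r : ℚ}
    (h : bev (XP b c) (partialSum 2 N) r = 0) :
    (2 : ℤ) ^ ((N !) - (N - 1)!) ∣ r.num + 1 ∧ r.num + 1 ≠ 0 := by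
  obtain ⟨e, hde, ha, h73, h7N⟩ := level_shape hb c hN h
  obtain ⟨m, rfl⟩ : ∃ m, N = m + 1 := ⟨N - 1, by omega⟩
  have hm2 : 2 ≤ m := by omega
  simp only [Nat.add_sub_cancel]
  -- the abscissa two levels deep
  set K : ℕ := (m + 1)! - m ! with hKdef
  have hsucc : (psNumer 2 (m + 1) : ℤ) = 2 ^ K * (psNumer 2 m : ℤ) + 1 := by
    rw [hKdef]; exact_mod_cast psNumer_succ 2 m
  have hpm : Odd (psNumer 2 m : ℤ) :=
    (Int.odd_coe_nat _).mpr (Nat.coprime_two_right.mp (coprime_psNumer 2 hm2))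
  have hu : Odd (psNumer 2 (m + 1) : ℤ) := odd_psNumer_two hN
  have hmfac : 1 ≤ m ! := Nat.one_le_iff_ne_zero.mpr (Nat.factorial_ne_zero m)
  have hfacsucc : (m + 1)! = (m + 1) * m ! := Nat.factorial_succ m
  have hK1 : 1 ≤ K := by
    rw [hKdef, hfacsucc]
    have : 2 * m ! ≤ (m + 1) * m ! := Nat.mul_le_mul_right _ (by omega)
    omega
  have hM : 1 ≤ (m + 1)! := Nat.one_le_iff_ne_zero.mpr (Nat.factorial_ne_zero _)
  rw [partialSum_two_eq_div] at h
  obtain ⟨e', hde', -, h73', hT⟩ := root_shape hb hu hM h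
  have hee : e' = e := by omega
  subst hee
  obtain ⟨f, hf⟩ : ∃ f, e' = 3 * f := ⟨e' / 3, by omega⟩
  have hMf : (m + 1)! = 7 * f := by omega
  set a : ℤ := r.num with hadef
  set u : ℤ := (psNumer 2 (m + 1) : ℤ) with hudef
  -- divide the tied equation by 2^{21f}: the CORE equation u³ + a⁷ + b·u·a·2^{11f} + c·2^{21f} = 0
  have hcoreE : u ^ 3 + a ^ 7 + b * u * a * 2 ^ (11 * f) + c * 2 ^ (21 * f) = 0 := by
    have e7 : 7 * e' = 21 * f := by omega
    have e3 : 3 * (m + 1)! = 21 * f := by omega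
    have e6 : 6 * e' + 2 * (m + 1)! = 21 * f + 11 * f := by omega
    rw [e7, e3, e6, pow_add] at hT
    have hT' : (2 : ℤ) ^ (21 * f) * (u ^ 3 + c * 2 ^ (21 * f) + b * u * a * 2 ^ (11 * f) + a ^ 7) = 0 := by
      linear_combination hT
    rcases mul_eq_zero.mp hT' with h2 | h2
    · exact absurd h2 (pow_ne_zero _ two_ne_zero)
    · linear_combination h2
  have hKf : K < 7 * f := by
    rw [← hMf, hKdef]; omega
  exact core hb hu hsucc hpm ha hK1 hKf hcoreE

/-- (P4) named: **`2^{N! − (N−1)!} ∣ num r + 1`** at a level point (`N ≠ 1`). -/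
theorem two_pow_dvd_num_add_one {b : ℤ} (hb : Odd b) (c : ℤ) {N : ℕ} (hN : N ≠ 1) {r : ℚ}
    (h : bev (XP b c) (partialSum 2 N) r = 0) : (2 : ℤ) ^ ((N !) - (N - 1)!) ∣ r.num + 1 :=
  (level_digits hb c hN h).1

/-- (P5) named: **`num r ≠ −1`** at a level point (`N ≠ 1`; the next digit of the abscissa). -/
theorem num_ne_neg_one {b : ℤ} (hb : Odd b) (c : ℤ) {N : ℕ} (hN : N ≠ 1) {r : ℚ}
    (h : bev (XP b c) (partialSum 2 N) r = 0) : r.num ≠ -1 := fun h1 =>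
  (level_digits hb c hN h).2 (by rw [h1]; norm_num)

/-- (P6) named: **the ordinate window at a level**: `|r| ≤ 2|b| + 8 + |c|` (any `N`, any `b`). -/
theorem abs_num_window {b c : ℤ} {N : ℕ} {r : ℚ} (h : bev (XP b c) (partialSum 2 N) r = 0) :
    |(r : ℝ)| ≤ 2 * |(b : ℝ)| + 8 + |(c : ℝ)| := by
  rw [bev_XP] at h
  exact window (partialSum_pos' (by norm_num) _) (partialSum_lt_two le_rfl _) h

/-- `K ≥ e + N`: with `K = N! − (N−1)!` and `7e = 3·N!`, for `N ≥ 7` (stated at `N = m + 1`). -/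
theorem exp_gap {m e : ℕ} (hm : 6 ≤ m) (he : 7 * e = 3 * (m + 1)!) : e + (m + 1) ≤ (m + 1)! - m ! := by
  have hF : m ≤ m ! := Nat.self_le_factorial m
  have hfac : (m + 1)! = (m + 1) * m ! := Nat.factorial_succ m
  rw [hfac] at he ⊢
  have hle : m ! ≤ (m + 1) * m ! := by nlinarith
  zify [hle] at he ⊢
  have hF' : (m : ℤ) ≤ (m ! : ℕ) := by exact_mod_cast hF
  have hm' : (6 : ℤ) ≤ m := by exact_mod_cast hm
  nlinarith [mul_le_mul_of_nonneg_left hF' (by linarith : (0 : ℤ) ≤ 4 * (m : ℤ) - 3),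
    mul_le_mul_of_nonneg_right hm' (by positivity : (0 : ℤ) ≤ (m : ℤ))]

/-- **THE PINCER — the pencil engine.**  For `b` odd, any `c`, and any level `N` with `2^N ≥ 2|b| + 9 + |c|`:
`XP b c` has NO rational point over `x = s_N`. -/
theorem no_level_XP_of_pow_le {b : ℤ} (hb : Odd b) {c : ℤ} {N : ℕ} (hN : 2 * b.natAbs + 9 + c.natAbs ≤ 2 ^ N)
    (r : ℚ) : bev (XP b c) (partialSum 2 N) r ≠ 0 := by
  intro h0
  -- N ≥ 4 from the size hypothesis, so N ≠ 1
  have hN1 : N ≠ 1 := by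
    rintro rfl
    have : (2 : ℕ) ^ 1 = 2 := by norm_num
    omega
  obtain ⟨e, hde, -, h73, h7N⟩ := level_shape hb c hN1 h0
  obtain ⟨hdvd, hne⟩ := level_digits hb c hN1 h0
  have hwin := abs_num_window h0
  obtain ⟨m, rfl⟩ : ∃ m, N = m + 1 := ⟨N - 1, by omega⟩
  simp only [Nat.add_sub_cancel] at hdvd
  have hm6 : 6 ≤ m := by omega
  set a : ℤ := r.num with hadef
  -- |a + 1| ≥ 2^K
  have hlow : (2 : ℝ) ^ ((m + 1)! - m !) ≤ |((a + 1 : ℤ) : ℝ)| := two_pow_le_abs_of_dvd hdvd hne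
  -- |a| ≤ R · 2^e
  have hdeR : ((r.den : ℕ) : ℝ) = (2 : ℝ) ^ e := by exact_mod_cast hde
  have hrad : (r : ℝ) = (a : ℝ) / (2 : ℝ) ^ e := by
    have e1 : ((r.num : ℚ) / (r.den : ℚ) : ℚ) = r := Rat.num_div_den r
    have e2 : (r : ℝ) = (((r.num : ℚ) / (r.den : ℚ) : ℚ) : ℝ) := by rw [e1]
    rw [e2, Rat.cast_div, Rat.cast_intCast, Rat.cast_natCast, hdeR]
  have h2e : (0 : ℝ) < (2 : ℝ) ^ e := by positivity
  have habs : |(a : ℝ)| ≤ (2 * |(b : ℝ)| + 8 + |(c : ℝ)|) * 2 ^ e := by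
    have : |(a : ℝ)| = |(r : ℝ)| * 2 ^ e := by
      rw [hrad, abs_div, abs_of_pos h2e, div_mul_cancel₀ _ h2e.ne']
    rw [this]
    exact mul_le_mul_of_nonneg_right hwin h2e.le
  -- K ≥ e + N
  have hgap : e + (m + 1) ≤ (m + 1)! - m ! := exp_gap hm6 h73
  have hpowK : (2 : ℝ) ^ (e + (m + 1)) ≤ 2 ^ ((m + 1)! - m !) := pow_le_pow_right₀ (by norm_num) hgap
  rw [pow_add] at hpowK
  -- the size hypothesis in ℝ
  have hRN : (2 * |(b : ℝ)| + 9 + |(c : ℝ)|) ≤ (2 : ℝ) ^ (m + 1) := by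
    have e1 : (2 * |(b : ℝ)| + 9 + |(c : ℝ)|) = ((2 * b.natAbs + 9 + c.natAbs : ℕ) : ℝ) := by
      push_cast; rw [Nat.cast_natAbs, Nat.cast_natAbs]; push_cast; ring
    rw [e1]; exact_mod_cast hN
  -- chain: 2^e · 2^N ≤ 2^K ≤ |a + 1| ≤ |a| + 1 ≤ R·2^e + 1 < (R + 1)·2^e ≤ 2^N · 2^e
  have htri : |((a + 1 : ℤ) : ℝ)| ≤ |(a : ℝ)| + 1 := by
    push_cast; calc |(a : ℝ) + 1| ≤ |(a : ℝ)| + |(1 : ℝ)| := abs_add_le _ _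
      _ = |(a : ℝ)| + 1 := by rw [abs_one]
  have h2le : (2 : ℝ) ≤ 2 ^ e := by
    have h := pow_le_pow_right₀ (by norm_num : (1 : ℝ) ≤ 2) (by omega : 1 ≤ e)
    rwa [pow_one] at h
  have hA : (2 : ℝ) ^ e * (2 * |(b : ℝ)| + 9 + |(c : ℝ)|) ≤ 2 ^ e * 2 ^ (m + 1) :=
    mul_le_mul_of_nonneg_left hRN h2e.le
  have hb0 := abs_nonneg (b : ℝ)
  have hc0 := abs_nonneg (c : ℝ)
  nlinarith [hA, hpowK, hlow, htri, habs, h2le]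

/-- **levels `0` and `2 ≤ N ≤ 6` are EMPTY for every odd `b` and every `c`** (the far edge cannot tie: `7 ∤ 3·N!`). -/
theorem no_level_XP_lt_seven {b : ℤ} (hb : Odd b) (c : ℤ) {N : ℕ} (hN1 : N ≠ 1) (hN : N < 7) (r : ℚ) :
    bev (XP b c) (partialSum 2 N) r ≠ 0 := fun h0 => by
  have := seven_le_of_level hb c hN1 h0
  omega

/-- **level finiteness of the whole pencil**, hypothesis-free. -/
theorem levelFinite_XP {b : ℤ} (hb : Odd b) (c : ℤ) : LevelFinite (XP b c) := by
  intro C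
  set N₀ : ℕ := 2 * b.natAbs + 9 + c.natAbs with hN₀
  refine (Set.finite_Iio N₀).subset ?_
  rintro N ⟨r, -, hP, -⟩
  by_contra hge
  simp only [Set.mem_Iio, not_lt] at hge
  have hpow : 2 * b.natAbs + 9 + c.natAbs ≤ 2 ^ N :=
    le_trans (le_trans hge (Nat.lt_two_pow_self).le) le_rfl
  exact no_level_XP_of_pow_le hb hpow r hP

/-- `BddLevelEmpty (XP b c)` (the B-side currency of node 12). -/
theorem bddLevelEmpty_XP {b : ℤ} (hb : Odd b) (c : ℤ) : BddLevelEmpty (XP b c) :=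
  (bddLevelEmpty_iff_levelFinite _).mpr (levelFinite_XP hb c)

/-- **`ThinFibreAt m₀ (XP b c)` at EVERY quality `m₀`** (no `m₀`-guard), hypothesis-free. -/
theorem thinFibreAt_XP {b : ℤ} (hb : Odd b) (c : ℤ) (m₀ : ℕ) : ThinFibreAt m₀ (XP b c) :=
  thinFibreAt_of_levelFinite (levelFinite_XP hb c) m₀

end Summit.Schanuel.Schanuel.Theorems.RootDecomp1KDigitPincer
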